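import Mathlib
import HarnessLib

/-!
# Stub `stub_vitaliUI` (S6), line `enstrophy-ui-transfer`, crux `MomentParity.ResolvedDissipation`

Abstract measure theory (Vitali-type step). If `g j, h : α → ℝ≥0∞` are a.e.-measurable with
`h ≤ liminf g j` a.e., all integrals finite and `∫ g j → ∫ h`, then the family `g j` is uniformly
integrable in the level form: for every `δ > 0` one finite threshold `C` gives
`∫ g j · 1{g j > C} ≤ δ` for every `j`.

Proof. `∫ min (g j) h → ∫ h` (Fatou from below plus the trivial bound `min (g j) h ≤ h`), hence the
one-sided `L¹` distance `∫ (g j - h) = ∫ g j - ∫ min (g j) h → 0`. On the super-level set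
`{g j > C}` one has `g j ≤ (g j - h) + h` and, by Markov, `μ {g j > C} ≤ S / C` for a uniform finite
bound `S` of the integrals; absolute continuity of `∫ h` then handles all large `j` at once, and
dominated convergence in the level `C = n → ∞` handles each of the finitely many remaining `j`.
(The finiteness of `μ` in the registered signature is not needed.)
-/

noncomputable section

-- `Summit.<Summit>.<Problem>`: single-conjunct summit, the duplicate namespace segment is mandated.
set_option linter.dupNamespace false

namespace Summit.AnomalousDissipation.AnomalousDissipation.Theorems.MomentParityResolvedDissipation.VitaliUI

open MeasureTheory Filter Topology Set
open scoped ENNReal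

variable {α : Type*} [MeasurableSpace α]

/-- Pointwise splitting `a = (a - b) + min a b` in `ℝ≥0∞` (truncated subtraction). -/
theorem eq_tsub_add_min (a b : ℝ≥0∞) : a = (a - b) + min a b := by
  rcases le_total a b with hab | hab
  · rw [tsub_eq_zero_of_le hab, min_eq_left hab, zero_add]
  · rw [min_eq_right hab, tsub_add_cancel_of_le hab]

/-- The level indicator composed with `f` is the set indicator of the super-level set of `f`. -/
theorem indicator_Ioi_id_apply {β : Type*} (C : ℝ≥0∞) (f : β → ℝ≥0∞) (x : β) :
    (Set.Ioi C).indicator id (f x) = {y | C < f y}.indicator f x := by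
  by_cases hx : C < f x
  · rw [Set.indicator_of_mem (show f x ∈ Set.Ioi C from hx),
      Set.indicator_of_mem (show x ∈ {y | C < f y} from hx), id]
  · rw [Set.indicator_of_notMem (show f x ∉ Set.Ioi C from hx),
      Set.indicator_of_notMem (show x ∉ {y | C < f y} from hx)]

/-- Truncated integrals converge: `∫ min (g j) h → ∫ h` under the Fatou hypothesis
`h ≤ liminf g j` a.e. (Fatou from below, trivial bound from above). -/
theorem tendsto_lintegral_min (μ : Measure α) (g : ℕ → α → ℝ≥0∞) (h : α → ℝ≥0∞)
    (hg : ∀ j, AEMeasurable (g j) μ) (hh : AEMeasurable h μ)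
    (hle : ∀ᵐ x ∂μ, h x ≤ Filter.liminf (fun j => g j x) Filter.atTop) :
    Tendsto (fun j => ∫⁻ x, min (g j x) (h x) ∂μ) atTop (𝓝 (∫⁻ x, h x ∂μ)) := by
  refine tendsto_of_le_liminf_of_limsup_le ?_ ?_
  · have hpt : ∀ᵐ x ∂μ, h x ≤ liminf (fun j => min (g j x) (h x)) atTop := by
      filter_upwards [hle] with x hx
      refine le_of_forall_lt_imp_le_of_dense fun b hb => le_liminf_of_le (by isBoundedDefault) ?_
      filter_upwards [eventually_lt_of_lt_liminf (hb.trans_le hx)] with n hn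
      exact le_min hn.le hb.le
    calc ∫⁻ x, h x ∂μ ≤ ∫⁻ x, liminf (fun j => min (g j x) (h x)) atTop ∂μ := lintegral_mono_ae hpt
      _ ≤ liminf (fun j => ∫⁻ x, min (g j x) (h x) ∂μ) atTop :=
          lintegral_liminf_le' fun j => (hg j).min hh
  · exact limsup_le_of_le (by isBoundedDefault)
      (Eventually.of_forall fun j => lintegral_mono fun x => min_le_right _ _)

/-- One-sided `L¹` convergence: `∫ (g j - h) → 0` (truncated subtraction), from the convergence of
the integrals and of the truncated integrals. -/
theorem tendsto_lintegral_tsub_zero (μ : Measure α) (g : ℕ → α → ℝ≥0∞) (h : α → ℝ≥0∞)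
    (hg : ∀ j, AEMeasurable (g j) μ) (hh : AEMeasurable h μ)
    (hle : ∀ᵐ x ∂μ, h x ≤ Filter.liminf (fun j => g j x) Filter.atTop)
    (hfin : ∫⁻ x, h x ∂μ ≠ ⊤)
    (hconv : Filter.Tendsto (fun j => ∫⁻ x, g j x ∂μ) Filter.atTop (𝓝 (∫⁻ x, h x ∂μ))) :
    Tendsto (fun j => ∫⁻ x, (g j x - h x) ∂μ) atTop (𝓝 0) := by
  have hm := tendsto_lintegral_min μ g h hg hh hle
  have hmfin : ∀ j, ∫⁻ x, min (g j x) (h x) ∂μ ≠ ⊤ := fun j =>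
    ne_top_of_le_ne_top hfin (lintegral_mono fun x => min_le_right _ _)
  have hsplit : ∀ j, ∫⁻ x, (g j x - h x) ∂μ = ∫⁻ x, g j x ∂μ - ∫⁻ x, min (g j x) (h x) ∂μ := by
    intro j
    have hgj : ∫⁻ x, g j x ∂μ = ∫⁻ x, (g j x - h x) ∂μ + ∫⁻ x, min (g j x) (h x) ∂μ := by
      rw [← lintegral_add_left' (f := fun x => g j x - h x) ((hg j).sub hh)]
      exact lintegral_congr fun x => eq_tsub_add_min (g j x) (h x)
    rw [hgj, ENNReal.add_sub_cancel_right (hmfin j)]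
  have key : Tendsto (fun j => ∫⁻ x, g j x ∂μ - ∫⁻ x, min (g j x) (h x) ∂μ) atTop (𝓝 0) := by
    have hsub := ENNReal.Tendsto.sub hconv hm (Or.inl hfin)
    rwa [tsub_self] at hsub
  exact key.congr fun j => (hsplit j).symm

/-- A convergent sequence in `ℝ≥0∞` with finite terms and finite limit is bounded by a finite
constant. -/
theorem exists_uniform_bound (u : ℕ → ℝ≥0∞) (L : ℝ≥0∞) (hL : L ≠ ⊤) (hu : ∀ j, u j ≠ ⊤)
    (hconv : Tendsto u atTop (𝓝 L)) : ∃ S : ℝ≥0∞, S ≠ ⊤ ∧ ∀ j, u j ≤ S := by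
  have hev : ∀ᶠ j in atTop, u j < L + 1 :=
    (tendsto_order.1 hconv).2 _ (ENNReal.lt_add_right hL one_ne_zero)
  obtain ⟨J, hJ⟩ := eventually_atTop.1 hev
  refine ⟨(L + 1) + ∑ j ∈ Finset.range J, u j, ?_, fun j => ?_⟩
  · exact ENNReal.add_ne_top.2 ⟨ENNReal.add_ne_top.2 ⟨hL, ENNReal.one_ne_top⟩,
      ENNReal.sum_ne_top.2 fun j _ => hu j⟩
  · rcases lt_or_ge j J with hj | hj
    · exact le_add_left (Finset.single_le_sum (fun _ _ => zero_le) (Finset.mem_range.2 hj))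
    · exact le_add_right (hJ j hj).le

/-- A single function with finite integral: along the levels `C = n → ∞` the level integrals
`∫ f · 1{f > n}` are eventually `≤ δ` (dominated convergence). -/
theorem eventually_lintegral_indicator_le (μ : Measure α) (f : α → ℝ≥0∞) (hf : AEMeasurable f μ)
    (hfin : ∫⁻ x, f x ∂μ ≠ ⊤) {δ : ℝ≥0∞} (hδ : 0 < δ) :
    ∀ᶠ n : ℕ in atTop, ∫⁻ x, (Set.Ioi (n : ℝ≥0∞)).indicator id (f x) ∂μ ≤ δ := by
  have hmeas : ∀ n : ℕ, AEMeasurable (fun x => (Set.Ioi (n : ℝ≥0∞)).indicator id (f x)) μ :=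
    fun n => (measurable_id.indicator measurableSet_Ioi).comp_aemeasurable hf
  have hbound : ∀ n : ℕ, (fun x => (Set.Ioi (n : ℝ≥0∞)).indicator id (f x)) ≤ᵐ[μ] f := fun n =>
    Eventually.of_forall fun x => Set.indicator_le_self _ _ (f x)
  have hlim : ∀ᵐ x ∂μ,
      Tendsto (fun n : ℕ => (Set.Ioi (n : ℝ≥0∞)).indicator id (f x)) atTop (𝓝 0) := by
    filter_upwards [ae_lt_top' hf hfin] with x hx
    obtain ⟨N, hN⟩ := ENNReal.exists_nat_gt hx.ne
    refine tendsto_const_nhds.congr' ?_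
    filter_upwards [eventually_ge_atTop N] with n hn
    refine (Set.indicator_of_notMem ?_ _).symm
    exact not_lt.2 (hN.le.trans (by exact_mod_cast hn))
  have hdc := tendsto_lintegral_of_dominated_convergence' f hmeas hbound hfin hlim
  rw [lintegral_zero] at hdc
  exact ((tendsto_order.1 hdc).2 δ hδ).mono fun n hn => hn.le

/-- Markov: the super-level set `{f > n}` of a function with `∫ f ≤ S` has measure `≤ S / n`. -/
theorem measure_superlevel_le (μ : Measure α) (f : α → ℝ≥0∞) (hf : AEMeasurable f μ) {S : ℝ≥0∞}
    (hS : ∫⁻ x, f x ∂μ ≤ S) {n : ℕ} (hn : n ≠ 0) :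
    μ {x | (n : ℝ≥0∞) < f x} ≤ S / n :=
  calc μ {x | (n : ℝ≥0∞) < f x} ≤ μ {x | (n : ℝ≥0∞) ≤ f x} :=
        measure_mono fun x (hx : (n : ℝ≥0∞) < f x) => show (n : ℝ≥0∞) ≤ f x from hx.le
    _ ≤ (∫⁻ x, f x ∂μ) / n :=
        meas_ge_le_lintegral_div hf (Nat.cast_ne_zero.2 hn) (ENNReal.natCast_ne_top n)
    _ ≤ S / n := ENNReal.div_le_div_right hS _

/-- **S6 · `stub_vitaliUI`.** Convergence of integrals plus Fatou from below implies uniform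
integrability in the level form: if `g j, h ≥ 0` are a.e.-measurable with `h ≤ liminf g j` a.e., all
integrals finite and `∫ g j → ∫ h`, then for every `δ > 0` one finite threshold `C` gives
`∫ g j · 1{g j > C} ≤ δ` for every `j`. -/
theorem stub_vitaliUI {α : Type*} [MeasurableSpace α] (μ : Measure α) [IsFiniteMeasure μ]
    (g : ℕ → α → ℝ≥0∞) (h : α → ℝ≥0∞) (hg : ∀ j, AEMeasurable (g j) μ) (hh : AEMeasurable h μ)
    (hle : ∀ᵐ x ∂μ, h x ≤ Filter.liminf (fun j => g j x) Filter.atTop)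
    (hfin : ∫⁻ x, h x ∂μ ≠ ⊤) (hgfin : ∀ j, ∫⁻ x, g j x ∂μ ≠ ⊤)
    (hconv : Filter.Tendsto (fun j => ∫⁻ x, g j x ∂μ) Filter.atTop (𝓝 (∫⁻ x, h x ∂μ))) :
    ∀ δ : ℝ≥0∞, 0 < δ → ∃ C : ℝ≥0∞, C ≠ ⊤ ∧
      ∀ j, ∫⁻ x, (Set.Ioi C).indicator id (g j x) ∂μ ≤ δ := by
  intro δ hδ
  have hδ2 : 0 < δ / 2 := ENNReal.half_pos hδ.ne'
  -- one-sided `L¹` convergence, uniform bound of the integrals, absolute continuity of `∫ h`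
  have hA := tendsto_lintegral_tsub_zero μ g h hg hh hle hfin hconv
  obtain ⟨J, hJ⟩ := eventually_atTop.1 ((tendsto_order.1 hA).2 (δ / 2) hδ2)
  obtain ⟨S, hS, hSj⟩ := exists_uniform_bound (fun j => ∫⁻ x, g j x ∂μ) _ hfin hgfin hconv
  obtain ⟨η, hη, hηh⟩ := exists_pos_setLIntegral_lt_of_measure_lt hfin hδ2.ne'
  -- along the levels `C = n → ∞` everything becomes small
  have E1 : ∀ᶠ n : ℕ in atTop, ∀ j ∈ Finset.range J,
      ∫⁻ x, (Set.Ioi (n : ℝ≥0∞)).indicator id (g j x) ∂μ ≤ δ :=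
    (Filter.eventually_all_finset _).2 fun j _ =>
      eventually_lintegral_indicator_le μ (g j) (hg j) (hgfin j) hδ
  have E2 : ∀ᶠ n : ℕ in atTop, S / n < η := by
    have hSn : Tendsto (fun n : ℕ => S / n) atTop (𝓝 (S / ⊤)) :=
      ENNReal.Tendsto.const_div ENNReal.tendsto_nat_nhds_top (Or.inr hS)
    rw [ENNReal.div_top] at hSn
    exact (tendsto_order.1 hSn).2 η hη
  obtain ⟨n, hn1, hn2, hn3⟩ := (E1.and (E2.and (eventually_ne_atTop 0))).exists
  refine ⟨n, ENNReal.natCast_ne_top n, fun j => ?_⟩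
  by_cases hj : j ∈ Finset.range J
  · exact hn1 j hj
  · have hJj : J ≤ j := not_lt.1 fun h' => hj (Finset.mem_range.2 h')
    set s : Set α := {x | (n : ℝ≥0∞) < g j x}
    have hμs : μ s < η := (measure_superlevel_le μ (g j) (hg j) (hSj j) hn3).trans_lt hn2
    calc ∫⁻ x, (Set.Ioi (n : ℝ≥0∞)).indicator id (g j x) ∂μ = ∫⁻ x, s.indicator (g j) x ∂μ :=
          lintegral_congr fun x => indicator_Ioi_id_apply _ _ _
      _ ≤ ∫⁻ x in s, g j x ∂μ := lintegral_indicator_le _ _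
      _ ≤ ∫⁻ x in s, (g j x - h x) + h x ∂μ := lintegral_mono fun x => le_tsub_add
      _ = ∫⁻ x in s, (g j x - h x) ∂μ + ∫⁻ x in s, h x ∂μ :=
          lintegral_add_left' ((hg j).sub hh).restrict _
      _ ≤ ∫⁻ x, (g j x - h x) ∂μ + ∫⁻ x in s, h x ∂μ :=
          add_le_add (setLIntegral_le_lintegral s _) le_rfl
      _ ≤ δ / 2 + δ / 2 := add_le_add (hJ j hJj).le (hηh s hμs).le
      _ = δ := ENNReal.add_halves δ

end Summit.AnomalousDissipation.AnomalousDissipation.Theorems.MomentParityResolvedDissipation.VitaliUI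

end
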